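import Summits.CriticalPhenomena.Ising3DConformalLimit.Theses.LinkingParityCircles
import Summits.CriticalPhenomena.Ising3DConformalLimit.Theorems.MoebiusLimitExists.Negative.FreeTranslations
import Summits.CriticalPhenomena.Ising3DConformalLimit.Theorems.IsingEuclidUpgradeR4NonGaussianFatStep
import Literature.Probability.LatticeModels.CriticalUrsellFourSign
import Summits.CriticalPhenomena.Ising3DConformalLimit.Theorems.MoebiusLimitOfTwoPointLaw.Negative.TwoPointConvergence
import HarnessLib

/-!
# Crux `LinkingParityCircles.SpinRatioMoebius` (stmt-CriticalPhenomena-4530), line `registered` —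
# stub `stub_scalingLimitOfRatioLimit`: the pinned SCALING LIMIT from the ratio limits

From locally uniform limits `q_{2m}` of the weight-free spin pairing ratios at every level (continuous,
translation and dilation invariant on the locus) and the pinned two-point limit `ψ`
(`⟨σ_{[x/δ]}σ_{[y/δ]}⟩/⟨σ₀σ_{⌊1/δ⌋e₀}⟩ → ψ(y − x)`, `ψ` continuous, positive, homogeneous of degree `−2Δ`), the
PINNED rescaled critical correlators `ρ(δ)ⁿ ⟨∏σ_{[xᵢ/δ]}⟩` with `ρ(δ)² = 1/⟨σ₀σ_{⌊1/δ⌋e₀}⟩` have the pointwise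
scaling limit `S`, `S n x = lim_{δ→0⁺} ρ(δ)ⁿ⟨∏σ_{[xᵢ/δ]}⟩` on the locus and `0` off it; on the locus
`S_{2m}(x) = q_{2m}(x) ∏_j ψ(x_{m+j} − x_j)` (the exact factorisation `ρ^{2m} G_{2m} = Q^δ_m · ∏_j ρ² G_2(pairs)` and
products of locally uniform limits), `S_odd = 0` (`criticalCorr_eq_zero_of_odd`), and `S` is non-degenerate
(`S_2 = ψ`, the level-2 ratio being identically `1`), translation invariant and scale covariant with dimension `Δ`.

References: S. Friedli, Y. Velenik (CUP 2017) Thm. 3.17; M. Aizenman, H. Duminil-Copin, V. Sidoravicius,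
Comm. Math. Phys. 334 (2015) (odd correlations vanish at `β_c`); H. Duminil-Copin (2019) Thm. 4.8.
-/

noncomputable section

namespace Summit.CriticalPhenomena.Ising3DConformalLimit.Cruxes.SpinRatioMoebius.Birth

open Literature.Probability.LatticeModels Filter Set Metric
open Summit.CriticalPhenomena.Ising3DConformalLimit.MoebiusLimitExistsNegative
open Summit.CriticalPhenomena.Ising3DConformalLimit.Cruxes.IsingEuclidUpgradeR4NonGaussian.FreeCovarianceDeltaDichotomy
  (criticalCorr_two_pos')
open scoped Topology

/-! ## §A Products of locally uniformly convergent families -/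

/-- Finite products of locally uniformly convergent real families with continuous limits converge locally
uniformly. [folklore] -/
theorem tendstoLocallyUniformlyOn_finsetProd {X ι α : Type*} [TopologicalSpace X] {p : Filter ι} {s : Set X}
    (T : Finset α) {F : α → ι → X → ℝ} {f : α → X → ℝ}
    (h : ∀ a ∈ T, TendstoLocallyUniformlyOn (F a) (f a) p s) (hc : ∀ a ∈ T, ContinuousOn (f a) s) :
    TendstoLocallyUniformlyOn (fun i x => ∏ a ∈ T, F a i x) (fun x => ∏ a ∈ T, f a x) p s := by
  classical
  induction T using Finset.induction_on with
  | empty =>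
    simp only [Finset.prod_empty]
    exact ((tendsto_const_nhds (x := (1 : ℝ))).tendstoUniformlyOn_const s).tendstoLocallyUniformlyOn
  | insert a T ha ih =>
    simp only [Finset.prod_insert ha]
    have h1 := h a (Finset.mem_insert_self a T)
    have h2 := ih (fun b hb => h b (Finset.mem_insert_of_mem hb)) (fun b hb => hc b (Finset.mem_insert_of_mem hb))
    have hc2 : ContinuousOn (fun x => ∏ b ∈ T, f b x) s :=
      continuousOn_finsetProd T fun b hb => hc b (Finset.mem_insert_of_mem hb)
    exact h1.mul₀ h2 (hc a (Finset.mem_insert_self a T)) hc2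

/-! ## §B The pinned renormalisation and the exact factorisation -/

/-- `0 < ⟨σ₀σ_{⌊1/δ⌋e₀}⟩`. [cite: DuminilCopin2019, Thm. 4.8, §4.4] -/
theorem pinRef_pos (δ : ℝ) : 0 < criticalCorr 3 2 ![(0 : Site 3), Pi.single (0 : Fin 3) (⌊1 / δ⌋ : ℤ)] :=
  criticalCorr_two_pos' _ _

/-- The pinned renormalisation squared is `1/⟨σ₀σ_{⌊1/δ⌋e₀}⟩`. [folklore] -/
theorem pinRho_sq (δ : ℝ) :
    ((Real.sqrt (criticalCorr 3 2 ![(0 : Site 3), Pi.single (0 : Fin 3) (⌊1 / δ⌋ : ℤ)]))⁻¹) ^ 2 =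
      (criticalCorr 3 2 ![(0 : Site 3), Pi.single (0 : Fin 3) (⌊1 / δ⌋ : ℤ)])⁻¹ := by
  rw [inv_pow, Real.sq_sqrt (pinRef_pos δ).le]

/-- At level `1 + 1` the pairing ratio is identically `1`. [folklore] -/
theorem pairingRatio_level_one (δ : ℝ) (x : Fin (1 + 1) → EuclideanSpace ℝ (Fin 3)) :
    criticalCorr 3 (1 + 1) (fun i => latticeApprox δ (x i)) /
      ∏ j : Fin 1, criticalCorr 3 2 ![latticeApprox δ (x (Fin.castAdd 1 j)), latticeApprox δ (x (Fin.natAdd 1 j))] = 1 := by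
  rw [Fin.prod_univ_one]
  have h : (fun i => latticeApprox δ (x i)) =
      ![latticeApprox δ (x (Fin.castAdd 1 0)), latticeApprox δ (x (Fin.natAdd 1 0))] := by
    funext i; fin_cases i <;> rfl
  rw [h]
  exact div_self (criticalCorr_two_pos' _ _).ne'

/-- EXACT FACTORISATION: `ρ^{m+m} ⟨∏σ_{[xᵢ/δ]}⟩ = Q^δ_m(x) · ∏_j (ρ² ⟨σ_{[x_j/δ]}σ_{[x_{m+j}/δ]}⟩)` for any `ρ`. [folklore] -/
theorem rescaled_even_factorisation (ρ : ℝ → ℝ) (m : ℕ) (δ : ℝ) (x : Fin (m + m) → EuclideanSpace ℝ (Fin 3)) :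
    rescaledCorrelator (criticalCorr 3) ρ (m + m) δ x =
      (criticalCorr 3 (m + m) (fun i => latticeApprox δ (x i)) /
          ∏ j : Fin m, criticalCorr 3 2 ![latticeApprox δ (x (Fin.castAdd m j)), latticeApprox δ (x (Fin.natAdd m j))]) *
        ∏ j : Fin m, (ρ δ ^ 2 *
          criticalCorr 3 2 ![latticeApprox δ (x (Fin.castAdd m j)), latticeApprox δ (x (Fin.natAdd m j))]) := by
  rw [rescaledCorrelator_apply, Finset.prod_mul_distrib, Finset.prod_const, Finset.card_univ, Fintype.card_fin,
    ← pow_mul, show 2 * m = m + m by ring]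
  have hP : (∏ j : Fin m, criticalCorr 3 2 ![latticeApprox δ (x (Fin.castAdd m j)), latticeApprox δ (x (Fin.natAdd m j))]) ≠ 0 :=
    Finset.prod_ne_zero_iff.2 fun j _ => (criticalCorr_two_pos' _ _).ne'
  field_simp

/-! ## §C The two-point factors converge -/

/-- Two paired indices of a non-coincident configuration give distinct points. [folklore] -/
theorem pair_sub_ne_zero {m : ℕ} {x : Fin (m + m) → EuclideanSpace ℝ (Fin 3)} (hx : x ∈ NonCoincident 3 (m + m))
    (j : Fin m) : x (Fin.natAdd m j) - x (Fin.castAdd m j) ≠ 0 := by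
  intro h0
  have heq : x (Fin.natAdd m j) = x (Fin.castAdd m j) := sub_eq_zero.1 h0
  have h1 := (mem_nonCoincident x).1 hx heq
  have hv : (Fin.natAdd m j).val = (Fin.castAdd m j).val := by rw [h1]
  simp [Fin.natAdd, Fin.castAdd] at hv
  omega

/-- The pair projection `x ↦ (x_j, x_{m+j})` maps the locus into the two-point locus. [folklore] -/
theorem pairProj_mapsTo (m : ℕ) (j : Fin m) :
    MapsTo (fun x : Fin (m + m) → EuclideanSpace ℝ (Fin 3) =>
      (![x (Fin.castAdd m j), x (Fin.natAdd m j)] : Fin 2 → EuclideanSpace ℝ (Fin 3)))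
      (NonCoincident 3 (m + m)) (NonCoincident 3 2) := by
  intro x hx
  rw [mem_nonCoincident]
  intro a b hab
  have hne : x (Fin.castAdd m j) ≠ x (Fin.natAdd m j) := fun h =>
    pair_sub_ne_zero hx j (sub_eq_zero.2 h.symm)
  fin_cases a <;> fin_cases b
  · rfl
  · exact absurd hab hne
  · exact absurd hab.symm hne
  · rfl

/-- The pair projection is continuous. [folklore] -/
theorem continuous_pairProj (m : ℕ) (j : Fin m) :
    Continuous fun x : Fin (m + m) → EuclideanSpace ℝ (Fin 3) =>
      (![x (Fin.castAdd m j), x (Fin.natAdd m j)] : Fin 2 → EuclideanSpace ℝ (Fin 3)) := by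
  refine continuous_pi fun a => ?_
  fin_cases a
  · exact continuous_apply _
  · exact continuous_apply _

/-- Each pinned two-point factor `ρ² ⟨σ_{[x_j/δ]}σ_{[x_{m+j}/δ]}⟩` converges to `ψ(x_{m+j} − x_j)` locally uniformly on
the locus. [folklore] -/
theorem tendsto_pairFactor {ψ : EuclideanSpace ℝ (Fin 3) → ℝ}
    (h2 : TendstoLocallyUniformlyOn (fun (δ : ℝ) (x : Fin 2 → EuclideanSpace ℝ (Fin 3)) =>
      criticalCorr 3 2 (fun i => latticeApprox δ (x i)) / criticalCorr 3 2 ![(0 : Site 3), Pi.single (0 : Fin 3) (⌊1 / δ⌋ : ℤ)])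
      (fun x => ψ (x 1 - x 0)) (𝓝[>] (0:ℝ)) (NonCoincident 3 2))
    (m : ℕ) (j : Fin m) :
    TendstoLocallyUniformlyOn
      (fun (δ : ℝ) (x : Fin (m + m) → EuclideanSpace ℝ (Fin 3)) =>
        ((Real.sqrt (criticalCorr 3 2 ![(0 : Site 3), Pi.single (0 : Fin 3) (⌊1 / δ⌋ : ℤ)]))⁻¹) ^ 2 *
          criticalCorr 3 2 ![latticeApprox δ (x (Fin.castAdd m j)), latticeApprox δ (x (Fin.natAdd m j))])
      (fun x => ψ (x (Fin.natAdd m j) - x (Fin.castAdd m j))) (𝓝[>] (0:ℝ)) (NonCoincident 3 (m + m)) := by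
  have h := h2.comp _ (pairProj_mapsTo m j) (continuous_pairProj m j).continuousOn
  refine h.congr fun δ x _ => ?_
  simp only [Function.comp_apply]
  have hcfg : (fun i => latticeApprox δ ((![x (Fin.castAdd m j), x (Fin.natAdd m j)] : Fin 2 → EuclideanSpace ℝ (Fin 3)) i)) =
      ![latticeApprox δ (x (Fin.castAdd m j)), latticeApprox δ (x (Fin.natAdd m j))] := by
    funext i; fin_cases i <;> rfl
  rw [hcfg, pinRho_sq, div_eq_inv_mul]

/-! ## §D The stub -/

/-- **Stub `stub_scalingLimitOfRatioLimit` (the pinned SCALING LIMIT from the ratio limits).** [folklore] -/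
theorem stub_scalingLimitOfRatioLimit :
    ∀ (q : Literature.Probability.LatticeModels.CorrFamily 3) (Δ : ℝ) (ψ : EuclideanSpace ℝ (Fin 3) → ℝ), (∀ m : ℕ, TendstoLocallyUniformlyOn (fun (δ : ℝ) (x : Fin (m + m) → EuclideanSpace ℝ (Fin 3)) => Literature.Probability.LatticeModels.criticalCorr 3 (m + m) (fun i => Literature.Probability.LatticeModels.latticeApprox δ (x i)) / ∏ j : Fin m, Literature.Probability.LatticeModels.criticalCorr 3 2 ![Literature.Probability.LatticeModels.latticeApprox δ (x (Fin.castAdd m j)), Literature.Probability.LatticeModels.latticeApprox δ (x (Fin.natAdd m j))]) (q (m + m)) (nhdsWithin 0 (Set.Ioi 0)) (Literature.Probability.LatticeModels.NonCoincident 3 (m + m))) → (∀ m : ℕ, ContinuousOn (q (m + m)) (Literature.Probability.LatticeModels.NonCoincident 3 (m + m))) → (∀ (m : ℕ) (v : EuclideanSpace ℝ (Fin 3)), ∀ x ∈ Literature.Probability.LatticeModels.NonCoincident 3 (m + m), q (m + m) (fun i => x i + v) = q (m + m) x) → (∀ (m : ℕ) (c : ℝ), 0 < c → ∀ x ∈ Literature.Probability.LatticeModels.NonCoincident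 3 (m + m), q (m + m) (fun i => c • x i) = q (m + m) x) → ContinuousOn ψ {0}ᶜ → (∀ u : EuclideanSpace ℝ (Fin 3), u ≠ 0 → 0 < ψ u) → (∀ c : ℝ, 0 < c → ∀ u : EuclideanSpace ℝ (Fin 3), u ≠ 0 → ψ (c • u) = c ^ (-(2 * Δ)) * ψ u) → TendstoLocallyUniformlyOn (fun (δ : ℝ) (x : Fin 2 → EuclideanSpace ℝ (Fin 3)) => Literature.Probability.LatticeModels.criticalCorr 3 2 (fun i => Literature.Probability.LatticeModels.latticeApprox δ (x i)) / Literature.Probability.LatticeModels.criticalCorr 3 2 ![(0 : Literature.Probability.LatticeModels.Site 3), Pi.single (0 : Fin 3) (⌊1 / δ⌋ : ℤ)]) (fun x => ψ (x 1 - x 0)) (nhdsWithin 0 (Set.Ioi 0)) (Literature.Probability.LatticeModels.NonCoincident 3 2) → ∃ (ρ : ℝ → ℝ) (S : Literature.Probability.LatticeModels.CorrFamily 3), (∀ δ ∈ Set.Ioc (0 : ℝ) 1, 0 < ρ δ) ∧ Literature.Probability.LatticeModels.HasPointwiseScalingLimit (Literature.Probability.LatticeModels.criticalCorr 3) ρ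 S ∧ (∀ (n : ℕ) (z : Fin n → EuclideanSpace ℝ (Fin 3)), z ∉ Literature.Probability.LatticeModels.NonCoincident 3 n → S n z = 0) ∧ Literature.Probability.LatticeModels.IsNondegenerateTwoPoint S ∧ Literature.Probability.LatticeModels.IsTranslationInvariant S ∧ Literature.Probability.LatticeModels.IsScaleCovariant Δ S ∧ (∀ m : ℕ, ∀ x ∈ Literature.Probability.LatticeModels.NonCoincident 3 (m + m), S (m + m) x = q (m + m) x * ∏ j : Fin m, ψ (x (Fin.natAdd m j) - x (Fin.castAdd m j))) := by
  intro q Δ ψ hq hcont htrans hdil hψc hψpos hψhom h2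
  classical
  -- the pinned renormalisation and the candidate limit
  set ρ : ℝ → ℝ := fun δ => (Real.sqrt (criticalCorr 3 2 ![(0 : Site 3), Pi.single (0 : Fin 3) (⌊1 / δ⌋ : ℤ)]))⁻¹ with hρ
  set P : (m : ℕ) → (Fin (m + m) → EuclideanSpace ℝ (Fin 3)) → ℝ :=
    fun m x => q (m + m) x * ∏ j : Fin m, ψ (x (Fin.natAdd m j) - x (Fin.castAdd m j)) with hP
  set S : CorrFamily 3 := fun n x =>
    if x ∈ NonCoincident 3 n then limUnder (𝓝[>] (0:ℝ)) (fun δ => rescaledCorrelator (criticalCorr 3) ρ n δ x) else 0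
    with hS
  -- even levels: locally uniform convergence to `P m`
  have heven : ∀ m : ℕ, TendstoLocallyUniformlyOn (rescaledCorrelator (criticalCorr 3) ρ (m + m)) (P m)
      (𝓝[>] (0:ℝ)) (NonCoincident 3 (m + m)) := by
    intro m
    have hfac : ∀ j ∈ (Finset.univ : Finset (Fin m)), TendstoLocallyUniformlyOn
        (fun (δ : ℝ) (x : Fin (m + m) → EuclideanSpace ℝ (Fin 3)) =>
          ρ δ ^ 2 * criticalCorr 3 2 ![latticeApprox δ (x (Fin.castAdd m j)), latticeApprox δ (x (Fin.natAdd m j))])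
        (fun x => ψ (x (Fin.natAdd m j) - x (Fin.castAdd m j))) (𝓝[>] (0:ℝ)) (NonCoincident 3 (m + m)) :=
      fun j _ => tendsto_pairFactor h2 m j
    have hfc : ∀ j ∈ (Finset.univ : Finset (Fin m)),
        ContinuousOn (fun x : Fin (m + m) → EuclideanSpace ℝ (Fin 3) => ψ (x (Fin.natAdd m j) - x (Fin.castAdd m j)))
          (NonCoincident 3 (m + m)) := by
      intro j _
      have hcs : Continuous fun x : Fin (m + m) → EuclideanSpace ℝ (Fin 3) => x (Fin.natAdd m j) - x (Fin.castAdd m j) :=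
        (continuous_apply (Fin.natAdd m j)).sub (continuous_apply (Fin.castAdd m j))
      exact hψc.comp hcs.continuousOn fun x hx => pair_sub_ne_zero hx j
    have hprod := tendstoLocallyUniformlyOn_finsetProd (Finset.univ : Finset (Fin m)) hfac hfc
    have hmul := (hq m).mul₀ hprod (hcont m) (continuousOn_finsetProd _ hfc)
    refine hmul.congr fun δ x _ => ?_
    exact (rescaled_even_factorisation ρ m δ x).symm
  -- values of `S`
  have hS_even : ∀ m : ℕ, ∀ x ∈ NonCoincident 3 (m + m), S (m + m) x = P m x := by
    intro m x hx
    simp only [hS, if_pos hx]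
    exact ((heven m).tendsto_at hx).limUnder_eq
  have hS_odd : ∀ n : ℕ, Odd n → ∀ x, S n x = 0 := by
    intro n hn x
    simp only [hS]
    split_ifs with hx
    · simp only [Theorems.MoebiusLimitOfTwoPointLaw.Negative.rescaledCorrelator_arity_odd ρ hn]
      exact (tendsto_const_nhds).limUnder_eq
    · rfl
  have hS_off : ∀ (n : ℕ) (z : Fin n → EuclideanSpace ℝ (Fin 3)), z ∉ NonCoincident 3 n → S n z = 0 := by
    intro n z hz
    simp only [hS, if_neg hz]
  -- the level-2 ratio limit is `1`
  have hq2 : ∀ x ∈ NonCoincident 3 (1 + 1), q (1 + 1) x = 1 := by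
    intro x hx
    have h1 := (hq 1).tendsto_at hx
    simp only [pairingRatio_level_one] at h1
    exact tendsto_nhds_unique h1 tendsto_const_nhds
  refine ⟨ρ, S, ?_, ?_, hS_off, ?_, ?_, ?_, fun m x hx => hS_even m x hx⟩
  · -- `ρ > 0`
    intro δ _
    exact inv_pos.2 (Real.sqrt_pos.2 (pinRef_pos δ))
  · -- the pointwise scaling limit
    intro n
    rcases Nat.even_or_odd n with ⟨m, rfl⟩ | hn
    · exact (heven m).congr_right fun x hx => (hS_even m x hx).symm
    · refine ((tendsto_const_nhds (x := (0 : ℝ))).tendstoUniformlyOn_const (NonCoincident 3 n)).tendstoLocallyUniformlyOn.congr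
        (fun δ x _ => (Theorems.MoebiusLimitOfTwoPointLaw.Negative.rescaledCorrelator_arity_odd ρ hn δ x).symm) |>.congr_right fun x _ => (hS_odd n hn x).symm
  · -- non-degeneracy: `S 2 (a, b) = ψ (b - a) > 0`
    intro x hx
    have hx' : x ∈ NonCoincident 3 (1 + 1) := hx
    rw [show S 2 x = S (1 + 1) x from rfl, hS_even 1 x hx']
    simp only [hP, Fin.prod_univ_one]
    rw [hq2 x hx', one_mul]
    exact hψpos _ (pair_sub_ne_zero hx' 0)
  · -- translation invariance
    intro n v x
    by_cases hx : x ∈ NonCoincident 3 n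
    · have hxv : (fun i => x i + v) ∈ NonCoincident 3 n := (add_mem_nonCoincident_iff v x).2 hx
      rcases Nat.even_or_odd n with ⟨m, rfl⟩ | hn
      · rw [hS_even m _ hxv, hS_even m x hx]
        simp only [hP, htrans m v x hx, add_sub_add_right_eq_sub]
      · rw [hS_odd n hn, hS_odd n hn]
    · have hxv : (fun i => x i + v) ∉ NonCoincident 3 n := fun h => hx ((add_mem_nonCoincident_iff v x).1 h)
      rw [hS_off n _ hxv, hS_off n x hx]
  · -- scale covariance with dimension `Δ`
    intro n c hc x
    by_cases hx : x ∈ NonCoincident 3 n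
    · have hcx : (fun i => c • x i) ∈ NonCoincident 3 n := by
        rw [mem_nonCoincident] at hx ⊢
        exact (smul_right_injective _ hc.ne').comp hx
      rcases Nat.even_or_odd n with ⟨m, rfl⟩ | hn
      · rw [hS_even m _ hcx, hS_even m x hx]
        simp only [hP, hdil m c hc x hx]
        have hfac : ∀ j : Fin m, ψ (c • x (Fin.natAdd m j) - c • x (Fin.castAdd m j)) =
            c ^ (-(2 * Δ)) * ψ (x (Fin.natAdd m j) - x (Fin.castAdd m j)) := by
          intro j
          rw [← smul_sub, hψhom c hc _ (pair_sub_ne_zero hx j)]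
        simp only [hfac, Finset.prod_mul_distrib, Finset.prod_const, Finset.card_univ, Fintype.card_fin]
        have hpow : (c ^ (-(2 * Δ))) ^ m = c ^ (-((m + m : ℕ) : ℝ) * Δ) := by
          rw [← Real.rpow_natCast, ← Real.rpow_mul hc.le]
          congr 1
          push_cast
          ring
        rw [hpow]
        ring
      · rw [hS_odd n hn, hS_odd n hn, mul_zero]
    · have hcx : (fun i => c • x i) ∉ NonCoincident 3 n := by
        intro h
        apply hx
        rw [mem_nonCoincident] at h ⊢
        exact Function.Injective.of_comp (f := fun y : EuclideanSpace ℝ (Fin 3) => c • y) h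
      rw [hS_off n _ hcx, hS_off n x hx, mul_zero]

end Summit.CriticalPhenomena.Ising3DConformalLimit.Cruxes.SpinRatioMoebius.Birth

end
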